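import Summits.QuantumAdvantage.AdviceFreeQNC0.AffBells33StairOps
import HarnessLib

/-!
# AffBells33 — `KernelPairs2MGF` PROVED (W-S4 of the L3 / staircase line; planner qa-qnc0-p2 g33, PROOF-STAIR.md §2/§8)

`Σ_{x odd} (4/5)^{pairs2 (J x)} ≤ C·κ^N·2^{N−1}` with `κ = 39/40` (`AffBells33.kernelPairs2MGF`), where `pairs2` counts the coin pairs
at cyclic distance two of the kernel line `J = kline x`.  Prover qn-prover-3 g20.

PROOF (the planner's recipe).  `AffBells22.sum_odd_le_sum_hardCore` moves the sum to hard-core words `v` with weight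
`2^{Z(v)}·(4/5)^{pairs2 v}`; dropping the cyclic wrap-around pairs and the cyclic part of the constraint only increases the sum
(`pow_pairs2_le_pwt`, `4/5 ≤ 1`), leaving LINEAR words with no two consecutive zeros, each zero weighted `2` and each zero pair at
distance two weighted `4/5` (`pwt`).  With the last two letters as the state, the partial sums `(E₁₁, E₁₀, E₀₁)` obey
`E₁₁' = E₁₁ + E₀₁`, `E₁₀' = 2E₁₁ + (8/5)E₀₁`, `E₀₁' = E₁₀` (`psum_succ`, cf. `Literature…HardCorePairsAtDistanceTwo` for the signed
case, Stanley EC1 §4.7 Ex. 4.7.7), and the planner's positive super-solution `u = (43, 20, 39)`, `u·M ≤ (39/20)·u`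
(`AffBells33.pairs2MGF_certificate`), gives `43E₁₁ + 20E₁₀ + 39E₀₁ ≤ 161·(39/20)^j` (`lpot_le`), hence the claim.
WHAT THIS IS NOT: THEOREM S (`StaircaseLoss3`) still needs W-S1 (chain formula) and W-S5 (assembly); no crux touched.
-/

noncomputable section

namespace Summit.QuantumAdvantage.AdviceFreeQNC0

open Finset Literature.Computability.QuantumComplexity Literature.Computability.QuantumComplexity.RingHLF
open AffBells22

namespace AffBells33

/-! ### Pair-weighted words -/

/-- The site two steps back (junk below `2`). -/
def sub2 {j : ℕ} (i : Fin j) : Fin j := ⟨i.val - 2, lt_of_le_of_lt (Nat.sub_le _ _) i.isLt⟩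

/-- Fugacity `2` per zero. -/
def zfac {j : ℕ} (v : Fin j → Bool) (i : Fin j) : ℝ := if v i = false then 2 else 1

/-- Weight `4/5` per zero pair at (linear) distance two, attached to the later site. -/
def pfac {j : ℕ} (v : Fin j → Bool) (i : Fin j) : ℝ :=
  if 2 ≤ i.val ∧ v (sub2 i) = false ∧ v i = false then 4 / 5 else 1

/-- The pair-weighted word weight `2^{#zeros}·(4/5)^{#linear zero pairs at distance two}`. -/
def pwt {j : ℕ} (v : Fin j → Bool) : ℝ := ∏ i : Fin j, zfac v i * pfac v i

/-- The weight is non-negative. -/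
theorem pwt_nonneg {j : ℕ} (v : Fin j → Bool) : 0 ≤ pwt v :=
  prod_nonneg fun i _ => by unfold zfac pfac; split_ifs <;> norm_num

/-- Old site factors are unchanged by `snoc`. -/
private theorem zfac_snoc_castSucc {n : ℕ} (v : Fin (n + 1) → Bool) (d : Bool) (i : Fin (n + 1)) :
    zfac (Fin.snoc v d : Fin (n + 2) → Bool) (Fin.castSucc i) = zfac v i := by
  unfold zfac; rw [Fin.snoc_castSucc]

/-- Old pair factors are unchanged by `snoc` (they look backwards). -/
private theorem pfac_snoc_castSucc {n : ℕ} (v : Fin (n + 1) → Bool) (d : Bool) (i : Fin (n + 1)) :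
    pfac (Fin.snoc v d : Fin (n + 2) → Bool) (Fin.castSucc i) = pfac v i := by
  unfold pfac
  have e : sub2 (Fin.castSucc i) = Fin.castSucc (sub2 i) := Fin.ext (by simp [sub2])
  rw [e, Fin.snoc_castSucc, Fin.snoc_castSucc]
  rfl

/-- Site factor of the appended letter. -/
private theorem zfac_snoc_last {n : ℕ} (v : Fin (n + 1) → Bool) (d : Bool) :
    zfac (Fin.snoc v d : Fin (n + 2) → Bool) (Fin.last (n + 1)) = if d = false then 2 else 1 := by
  unfold zfac; rw [Fin.snoc_last]

/-- Pair factor of the appended letter (`n ≥ 1`). -/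
private theorem pfac_snoc_last {n : ℕ} (hn : 1 ≤ n) (v : Fin (n + 1) → Bool) (d : Bool) :
    pfac (Fin.snoc v d : Fin (n + 2) → Bool) (Fin.last (n + 1)) =
      if v ⟨n - 1, by omega⟩ = false ∧ d = false then 4 / 5 else 1 := by
  unfold pfac
  have h : 2 ≤ (Fin.last (n + 1)).val := by simp; omega
  have e : sub2 (Fin.last (n + 1) : Fin (n + 2)) = Fin.castSucc ⟨n - 1, by omega⟩ := Fin.ext (by simp [sub2])
  rw [e, Fin.snoc_castSucc, Fin.snoc_last]
  simp only [h, true_and]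

/-- Weight of a snoc-extended word. -/
private theorem pwt_snoc {n : ℕ} (hn : 1 ≤ n) (v : Fin (n + 1) → Bool) (d : Bool) :
    pwt (Fin.snoc v d : Fin (n + 2) → Bool) =
      pwt v * (if d = false then 2 else 1) * (if v ⟨n - 1, by omega⟩ = false ∧ d = false then 4 / 5 else 1) := by
  unfold pwt
  rw [Fin.prod_univ_castSucc, mul_assoc]
  congr 1
  · exact prod_congr rfl fun i _ => by rw [zfac_snoc_castSucc, pfac_snoc_castSucc]
  · rw [zfac_snoc_last, pfac_snoc_last hn]

/-! ### Partial sums with the last two letters as state -/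

open scoped Classical in
/-- `psum j b c`: weighted sum over words of length `j + 2` with no two consecutive zeros, last two letters `(b, c)`. -/
def psum (j : ℕ) (b c : Bool) : ℝ :=
  ∑ v : Fin (j + 2) → Bool, if (NoAdj v ∧ v ⟨j, by omega⟩ = b ∧ v (Fin.last (j + 1)) = c) then pwt v else 0

/-- The partial sums are non-negative. -/
theorem psum_nonneg (j : ℕ) (b c : Bool) : 0 ≤ psum j b c :=
  sum_nonneg fun v _ => by split_ifs <;> [exact pwt_nonneg v; norm_num]

/-- Transfer coefficient: appending `d` after `(b, c)`. -/
def pcoef (b c d : Bool) : ℝ :=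
  if (c = false ∧ d = false) then 0 else (if d = false then 2 else 1) * (if (b = false ∧ d = false) then 4 / 5 else 1)

/-- Evaluation of a snoc-extended word at an old site given by its value. -/
private theorem snoc_at_castSucc {n : ℕ} (u : Fin (n + 1) → Bool) (d : Bool) (k : ℕ) (hk : k < n + 1) :
    (Fin.snoc u d : Fin (n + 2) → Bool) ⟨k, by omega⟩ = u ⟨k, hk⟩ := by
  have e : (⟨k, by omega⟩ : Fin (n + 2)) = Fin.castSucc ⟨k, hk⟩ := Fin.ext (by simp)
  rw [e, Fin.snoc_castSucc]

/-- **Transfer recursion**: `psum (j+1) c d = Σ_b pcoef b c d · psum j b c`. -/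
theorem psum_succ (j : ℕ) (c d : Bool) : psum (j + 1) c d = ∑ b : Bool, pcoef b c d * psum j b c := by
  classical
  unfold psum
  rw [sum_snoc, Fintype.sum_bool]
  have hkill : ∀ e : Bool, e ≠ d →
      (∑ u : Fin (j + 2) → Bool,
        (if (NoAdj (Fin.snoc u e : Fin (j + 3) → Bool) ∧ (Fin.snoc u e : Fin (j + 3) → Bool) ⟨j + 1, by omega⟩ = c ∧
              (Fin.snoc u e : Fin (j + 3) → Bool) (Fin.last (j + 2)) = d)
          then pwt (Fin.snoc u e : Fin (j + 3) → Bool) else 0)) = 0 := by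
    intro e he
    refine sum_eq_zero fun u _ => ?_
    rw [Fin.snoc_last]
    simp [he]
  have hkeep : (∑ u : Fin (j + 2) → Bool,
        (if (NoAdj (Fin.snoc u d : Fin (j + 3) → Bool) ∧ (Fin.snoc u d : Fin (j + 3) → Bool) ⟨j + 1, by omega⟩ = c ∧
              (Fin.snoc u d : Fin (j + 3) → Bool) (Fin.last (j + 2)) = d)
          then pwt (Fin.snoc u d : Fin (j + 3) → Bool) else 0))
      = ∑ b : Bool, pcoef b c d * ∑ u : Fin (j + 2) → Bool,
          (if (NoAdj u ∧ u ⟨j, by omega⟩ = b ∧ u (Fin.last (j + 1)) = c) then pwt u else 0) := by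
    rw [Fintype.sum_bool, mul_sum, mul_sum, ← sum_add_distrib]
    refine sum_congr rfl fun u _ => ?_
    have ej1 : (Fin.snoc u d : Fin (j + 3) → Bool) ⟨j + 1, by omega⟩ = u (Fin.last (j + 1)) := by
      have : (⟨j + 1, by omega⟩ : Fin (j + 3)) = Fin.castSucc (Fin.last (j + 1)) := Fin.ext (by simp)
      rw [this, Fin.snoc_castSucc]
    have ej : (⟨(j + 1) - 1, by omega⟩ : Fin (j + 2)) = ⟨j, by omega⟩ := Fin.ext (by simp)
    rw [Fin.snoc_last, ej1]
    simp only [noAdj_snoc_iff]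
    rw [pwt_snoc (by omega) u d, ej]
    unfold pcoef
    by_cases hN : NoAdj u
    · cases hb : u ⟨j, by omega⟩ <;> cases hc : u (Fin.last (j + 1)) <;> cases c <;> cases d <;> simp [hN] <;> ring
    · simp [hN]
  cases d
  · rw [hkill true (by decide), zero_add, hkeep]
  · rw [hkill false (by decide), add_zero, hkeep]

/-- Words cannot end in two zeros. -/
theorem psum_false_false (j : ℕ) : psum j false false = 0 := by
  classical
  unfold psum
  refine sum_eq_zero fun v _ => ?_
  split_ifs with h
  · exfalso
    obtain ⟨hN, hb, hc⟩ := h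
    have hlt : (⟨j, by omega⟩ : Fin (j + 2)).val + 1 < j + 2 := by simp
    refine hN ⟨j, by omega⟩ hlt ⟨hb, ?_⟩
    have e : (⟨(⟨j, by omega⟩ : Fin (j + 2)).val + 1, hlt⟩ : Fin (j + 2)) = Fin.last (j + 1) := Fin.ext (by simp)
    rw [e]; exact hc
  · rfl

/-- Row `11`: `E₁₁' = E₁₁ + E₀₁`. -/
theorem psum_succ_tt (j : ℕ) : psum (j + 1) true true = psum j true true + psum j false true := by
  rw [psum_succ, Fintype.sum_bool]; unfold pcoef; simp

/-- Row `10`: `E₁₀' = 2E₁₁ + (8/5)E₀₁`. -/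
theorem psum_succ_tf (j : ℕ) : psum (j + 1) true false = 2 * psum j true true + 8 / 5 * psum j false true := by
  rw [psum_succ, Fintype.sum_bool]; unfold pcoef; norm_num

/-- Row `01`: `E₀₁' = E₁₀`. -/
theorem psum_succ_ft (j : ℕ) : psum (j + 1) false true = psum j true false := by
  rw [psum_succ, Fintype.sum_bool, psum_false_false]; unfold pcoef; simp

/-- The initial values (words of length two): `E₁₁ = 1`, `E₁₀ = 2`, `E₀₁ = 2`. -/
theorem psum_zero : psum 0 true true = 1 ∧ psum 0 true false = 2 ∧ psum 0 false true = 2 := by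
  classical
  have key : ∀ b c : Bool, (b = true ∨ c = true) →
      psum 0 b c = (if b = false then 2 else 1) * (if c = false then 2 else 1) := by
    intro b c hbc
    unfold psum
    rw [Fintype.sum_eq_single (fun i : Fin 2 => if i = 0 then b else c)]
    · have hN : NoAdj (fun i : Fin 2 => if i = 0 then b else c) := by
        intro i hi ⟨h1, h2⟩
        have hi0 : i = 0 := Fin.ext (by simp at hi; omega)
        subst hi0
        simp at h1 h2
        rcases hbc with h | h
        · rw [h] at h1; exact Bool.noConfusion h1
        · rw [h] at h2; exact Bool.noConfusion h2
      simp only [hN, true_and]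
      rw [if_pos ⟨by simp, by simp [Fin.last]⟩]
      unfold pwt zfac pfac
      rw [Fin.prod_univ_two]
      simp [sub2]
    · intro v hv
      rw [if_neg]
      rintro ⟨-, h0, h1⟩
      apply hv
      funext i
      fin_cases i
      · simpa using h0
      · simpa [Fin.last] using h1
  refine ⟨?_, ?_, ?_⟩
  · rw [key true true (Or.inl rfl)]; simp
  · rw [key true false (Or.inl rfl)]; simp
  · rw [key false true (Or.inr rfl)]; simp

/-! ### The positive super-solution `u = (43, 20, 39)` -/

/-- The linear potential `43E₁₁ + 20E₁₀ + 39E₀₁`. -/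
def lpot (j : ℕ) : ℝ := 43 * psum j true true + 20 * psum j true false + 39 * psum j false true

/-- One step: `lpot (j+1) ≤ (39/20)·lpot j` (the certificate `u·M ≤ (39/20)u`, positivity of the partial sums). -/
theorem lpot_succ_le (j : ℕ) : lpot (j + 1) ≤ 39 / 20 * lpot j := by
  unfold lpot
  rw [psum_succ_tt, psum_succ_tf, psum_succ_ft]
  have h1 := psum_nonneg j true true
  have h2 := psum_nonneg j true false
  have h3 := psum_nonneg j false true
  nlinarith

/-- `lpot j ≤ 161·(39/20)^j`. -/
theorem lpot_le (j : ℕ) : lpot j ≤ 161 * (39 / 20 : ℝ) ^ j := by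
  induction j with
  | zero =>
    obtain ⟨h1, h2, h3⟩ := psum_zero
    unfold lpot; rw [h1, h2, h3]; norm_num
  | succ j ih =>
    calc lpot (j + 1) ≤ 39 / 20 * lpot j := lpot_succ_le j
      _ ≤ 39 / 20 * (161 * (39 / 20 : ℝ) ^ j) := by nlinarith
      _ = 161 * (39 / 20 : ℝ) ^ (j + 1) := by rw [pow_succ]; ring

/-- **Total weight of the linear words**: `Σ_{v : NoAdj} pwt v ≤ (161/20)·(39/20)^j` for words of length `j + 2`. -/
theorem total_pwt_le (j : ℕ) :
    ∑ v : Fin (j + 2) → Bool, (if NoAdj v then pwt v else 0) ≤ 161 / 20 * (39 / 20 : ℝ) ^ j := by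
  classical
  have hsplit : ∑ v : Fin (j + 2) → Bool, (if NoAdj v then pwt v else 0) = ∑ b : Bool, ∑ c : Bool, psum j b c := by
    unfold psum
    rw [Finset.sum_comm]
    simp_rw [Finset.sum_comm (s := (univ : Finset Bool)) (t := (univ : Finset (Fin (j + 2) → Bool)))]
    refine sum_congr rfl fun v _ => ?_
    rw [Fintype.sum_bool, Fintype.sum_bool, Fintype.sum_bool]
    by_cases hN : NoAdj v
    · cases hb : v ⟨j, by omega⟩ <;> cases hc : v (Fin.last (j + 1)) <;> simp [hN]
    · simp [hN]
  rw [hsplit, Fintype.sum_bool, Fintype.sum_bool, Fintype.sum_bool, psum_false_false]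
  have h := lpot_le j
  unfold lpot at h
  have h1 := psum_nonneg j true true
  have h2 := psum_nonneg j true false
  have h3 := psum_nonneg j false true
  nlinarith

/-! ### From the kernel line to the linear words -/

/-- `Π zfac = 2^{Z}` and the linear pairs are among the cyclic pairs: `2^{Z(v)}·(4/5)^{pairs2 v} ≤ pwt v`. -/
theorem pow_pairs2_le_pwt {N : ℕ} (v : Fin N → Bool) :
    (2 : ℝ) ^ Fib19.zeros v * (4 / 5 : ℝ) ^ AffBells26.pairs2 v ≤ pwt v := by
  classical
  unfold pwt
  rw [prod_mul_distrib]
  have hz : (∏ i : Fin N, zfac v i) = (2 : ℝ) ^ Fib19.zeros v := by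
    unfold Fib19.zeros zfac
    rw [AffBells21.pow_card_filter_eq_prod_ite]
  have hp : (∏ i : Fin N, pfac v i) =
      (4 / 5 : ℝ) ^ (univ.filter fun i : Fin N => 2 ≤ i.val ∧ v (sub2 i) = false ∧ v i = false).card := by
    unfold pfac
    rw [AffBells21.pow_card_filter_eq_prod_ite]
  rw [hz, hp]
  refine mul_le_mul_of_nonneg_left ?_ (by positivity)
  apply pow_le_pow_of_le_one (by norm_num) (by norm_num)
  -- the linear pairs inject into the cyclic pairs via `i ↦ i − 2`
  unfold AffBells26.pairs2
  refine Finset.card_le_card_of_injOn sub2 ?_ ?_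
  · intro i hi
    rw [mem_coe, mem_filter] at hi ⊢
    obtain ⟨-, h2, ha, hb⟩ := hi
    refine ⟨mem_univ _, ha, ?_⟩
    have e : nxt (nxt (sub2 i)) = i := by
      apply Fin.ext
      have hi2 := i.isLt
      show ((i.val - 2 + 1) % N + 1) % N = i.val
      rw [Nat.mod_eq_of_lt (show i.val - 2 + 1 < N by omega), show i.val - 2 + 1 + 1 = i.val by omega,
        Nat.mod_eq_of_lt hi2]
    rw [e]; exact hb
  · intro i hi i' hi' h
    rw [mem_coe, mem_filter] at hi hi'
    apply Fin.ext
    have := congrArg Fin.val h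
    simp only [sub2] at this
    omega

/-- **W-S4 PROVED**: `KernelPairs2MGF` with `κ = 39/40`, `C = (161/40)·(1600/1521)`. -/
theorem kernelPairs2MGF : KernelPairs2MGF := by
  classical
  refine ⟨39 / 40, by norm_num, by norm_num, 161 / 40 * (1600 / 1521), fun N hN => ?_⟩
  obtain ⟨j, rfl⟩ : ∃ j, N = j + 2 := ⟨N - 2, by omega⟩
  have h1 := sum_odd_le_sum_hardCore hN (fun v => (4 / 5 : ℝ) ^ AffBells26.pairs2 v) (fun v => by positivity)
  refine h1.trans ?_
  have h2 : ∑ v ∈ (univ.filter fun v : Fin (j + 2) → Bool => Fib19.HardCore v),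
      (2 : ℝ) ^ Fib19.zeros v * (4 / 5 : ℝ) ^ AffBells26.pairs2 v
      ≤ ∑ v : Fin (j + 2) → Bool, (if NoAdj v then pwt v else 0) := by
    calc ∑ v ∈ (univ.filter fun v : Fin (j + 2) → Bool => Fib19.HardCore v),
          (2 : ℝ) ^ Fib19.zeros v * (4 / 5 : ℝ) ^ AffBells26.pairs2 v
        ≤ ∑ v ∈ (univ.filter fun v : Fin (j + 2) → Bool => Fib19.HardCore v), pwt v :=
          sum_le_sum fun v _ => pow_pairs2_le_pwt v
      _ ≤ ∑ v ∈ (univ.filter fun v : Fin (j + 2) → Bool => NoAdj v), pwt v := by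
          refine sum_le_sum_of_subset_of_nonneg ?_ (fun v _ _ => pwt_nonneg v)
          intro v hv
          rw [mem_filter] at hv ⊢
          exact ⟨mem_univ _, noAdj_of_hardCore hv.2⟩
      _ = ∑ v : Fin (j + 2) → Bool, (if NoAdj v then pwt v else 0) := by rw [sum_filter]
  refine h2.trans ((total_pwt_le j).trans (le_of_eq ?_))
  rw [show j + 2 - 1 = j + 1 from by omega, pow_add, pow_succ, pow_one]
  have : (39 / 20 : ℝ) ^ j = (39 / 40 : ℝ) ^ j * 2 ^ j := by rw [← mul_pow]; norm_num
  rw [this]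
  ring

end AffBells33

end Summit.QuantumAdvantage.AdviceFreeQNC0

end
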